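import Summits.AnomalousDissipation.AnomalousDissipation.Theorems.MomentParityGalerkinInvariantLoudStubKrylovBogoliubovTested
import Summits.AnomalousDissipation.AnomalousDissipation.Theorems.MomentParityGalerkinInvariantLoudStubUpperSemicontinuity

/-!
# Line `conley-continuation-loud-saddles` — LEAD'S SKELETON (reshape r2) for the crux
# `MomentParity.GalerkinInvariantLoud` (stmt-AnomalousDissipation-14283, route MomentParity)

Lead: prover-line-stmt-AnomalousDissipation-14283-c1-0 (continuation lead, 2026-08-17), from the planner's
checked skeleton `Cruxes/GalerkinInvariantLoud/Lines/conley_continuation_loud_saddles.lean`.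

**The line.** Existence theory for loud Galerkin-invariant ensembles is done for invariant SETS: at each
viscosity `ν_j` a norm-compact set `K_j ⊂ H` of the Navier–Stokes dynamics ALL of whose stationary laws
(Foias–Prodi generator identity for every cylindrical test functional, no energy clause) are loud and
bounded, SHADOWED for every large Galerkin level `N` by a nonempty closed forward-invariant level-`N` set
`Ks N` of the Galerkin dynamics (every point issues a tested Galerkin path staying inside), the shadows
accumulating on `K_j` in the norm of `H`. Upper semicontinuity of invariant laws (`stub_upperSemicontinuity`)
makes every Galerkin-invariant law carried by `Ks N` loud-bounded for large `N`; Krylov–Bogoliubov +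
Liouville at level `N` (`stub_krylovBogoliubov`) produces such a law as the generalized time average of one
Galerkin path in `Ks N`; `GalerkinInvariantLoud_of` (kernel-checked, no `sorry` of its own) concludes the
crux BY NAME (`∀ᶠ N ⇒ ∃ᶠ N`, radius from compactness of `K_j` + accumulation at `η = 1`).

**Reshape r2 (this lead) vs the planner's r1.** (a) No line-local definitions: every stub is stated over
BUILT tree vocabulary only (`QuarticGate.Negative.{IsLevel, IsBandTest, polyGrad}`,
`GalerkinInvariantLoud.Negative.IsInvariant`, `Torus.CylindricalTest`, `Torus.IsTimeAverageMeasure`,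
`GeneralizedLimit`), so each stub lands as a stand-alone `--supports` file with no Defs module.
(b) `stub_upperSemicontinuity` is stated with the hypotheses its proof uses: `K` norm-COMPACT (not
`V`-compact), accumulation in the NORM of `H` only, no compactness of the shadows — the enstrophy enters
only through LOWER semicontinuity on `H` (portmanteau for the lsc spectral `eGradNormSq`) and the
`N`-uniform budget `ν∫‖∇u‖² = ∫(u,f) ≤ R‖f‖₂` of the energy row; tightness is Rellich–Prokhorov
(`MomentParityResolvedDissipation.stub_tightExtraction`), the generator identity of the limit is
`MomentParityResolvedDissipation.LimitSSS.generator_limit`. (c) `stub_krylovBogoliubov` drops the unused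
hypotheses (`0 < ν`, solenoidality of `f`). (d) `stub_indexedLoudShadows` is weakened accordingly (norm
compactness, norm accumulation, closed shadows) — strictly easier to witness, same composition.

**Disproof used** (`Cruxes/GalerkinInvariantLoud/Disproof.lean` rev 5, NO KILL; landed
`Theorems/GalerkinInvariantLoud/Negative/*`): `not_gilBoundedLevel` honoured (`∀ᶠ N`, `N → ∞` in Stub 2),
`not_gilEveryForce` / `not_gilSubFloor` / `not_gilSmallRadius` honoured at Stub 3 (force, window existential;
radius produced, never posited); `gilFixedViscosity_holds` shows Stub 3's per-`j` structure is inhabited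
(laminar Dirac, `K = Ks N = {u_lam}`): the `j`-UNIFORM window is the whole content (the zeroth law for
shadowed loud carriers). No `-- Targets` theorem is posted against a stub of this line.
-/

noncomputable section

-- every `Summit.AnomalousDissipation.AnomalousDissipation.…` name repeats the summit = sub-problem segment
set_option linter.dupNamespace false

namespace Summit.AnomalousDissipation.AnomalousDissipation.Cruxes.GalerkinInvariantLoud.ConleyContinuationLoudSaddles

open MeasureTheory Filter Topology Set Metric
open scoped ENNReal
open Literature.Analysis.FunctionSpaces Literature.Analysis.FluidPDE
open Summit.AnomalousDissipation.AnomalousDissipation.Theses.MomentParity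
open Summit.AnomalousDissipation.AnomalousDissipation.Theorems.CubicParityLoud.Negative (T3 R3 H3)
open Summit.AnomalousDissipation.AnomalousDissipation.Theorems.QuarticGate.Negative (IsLevel IsBandTest polyGrad)
open Summit.AnomalousDissipation.AnomalousDissipation.Theorems.GalerkinInvariantLoud.Negative
  (IsInvariant IsGILWitness galerkinInvariantLoud_iff)

/-! ## The registered stubs -/

/-- **Stub 1 (M; LANDED p148750 as `Theorems.GalerkinInvariantLoud.KrylovBogoliubovTested.stub_krylovBogoliubov`; Galerkin Krylov–Bogoliubov + Liouville for tested paths, generalized-limit form).**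
A path `U : [0, ∞) → H`, norm-continuous, level-`N` and bounded by `R` for `t ≥ 0`, solving the Galerkin
equations at `(ν, f)` in time-integrated form against every level-`N` band test, has — for every
generalized (Banach) limit `Λ` — a time-average measure `μ` (`∫ Ψ dμ = Lim_T T⁻¹∫₀ᵀ Ψ(U t) dt` for bounded
continuous `Ψ`), and every such `μ` is all-order polynomially stationary for Galerkin NS at `(ν, f, N)`.
Existence: the functional `Ψ ↦ Λ.longTimeAvg (Ψ ∘ U)` is linear (`Torus.exists_linearMap_longTimeAvg`),
positive, normalised (`longTimeAvg_one`) and tight with the single compact level ball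
`{IsLevel N} ∩ B̄_R` (`MomentParityMomentClosure.isCompact_levelBall`; a bounded continuous `g` vanishing
there has `timeMean (g ∘ U) T = 0` for `T > 0`), so `RieszRepresentation.exists_probabilityMeasure_of_isTightFunctional`
applies (as in `exists_timeAverageMeasure_holds`). Rows: by FTC from the tested equation (integrand
`τ ↦ ⟨F(U τ), a⟩` continuous on `[0, ∞)`), `d/dt (U t, gᵢ) = ⟨F(U t), gᵢ⟩` for `t > 0`; chain rule
(`hasFDerivAt_eval`, `nsGeneratorPairing_polyGrad`) gives `∫₀ᵀ ⟨F(U t), ∇p(U t)⟩ dt = P(T) − P(0)`, bounded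
on the level ball, so the time means of the (continuous, `continuous_nsGeneratorPairing_polyGrad`) row tend
to `0`; transport to `μ` by `IsTimeAverageMeasure.integral_eq_of_eqOn` (closed level ball). [folklore] -/
theorem stub_krylovBogoliubov :
    ∀ (ν : ℝ) (f : T3 → R3) (N : ℕ) (R : ℝ) (U : ℝ → H3),
      Torus.IsSmooth f →
      ContinuousOn U (Ici 0) → (∀ t, 0 ≤ t → IsLevel N (U t)) → (∀ t, 0 ≤ t → ‖U t‖ ≤ R) →
      (∀ a : T3 → R3, IsBandTest N a → ∀ s t : ℝ, 0 ≤ s → s ≤ t →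
        Torus.pairing (U t).1 a - Torus.pairing (U s).1 a =
          ∫ τ in s..t, Torus.nsGeneratorPairing ν f (U τ) a) →
      ∀ Λ : GeneralizedLimit, ∃ μ : Measure H3,
        Torus.IsTimeAverageMeasure Λ.longTimeAvg U μ ∧ IsInvariant ν f N μ :=
  Theorems.GalerkinInvariantLoud.KrylovBogoliubovTested.stub_krylovBogoliubov

/-- **Stub 2 (M–L; LANDED p149730 as `Theorems.GalerkinInvariantLoud.UpperSemicontinuity.stub_upperSemicontinuity`; upper semicontinuity of invariant Galerkin laws onto a compact loud carrier, fixed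
`ν > 0`).** Let `K ⊆ H` be norm-compact and suppose EVERY law carried by `K` that is stationary for
Navier–Stokes at `(ν, f)` (probability, `μ(H ∖ K) = 0`, generator identity for every cylindrical test
functional) has energy `< E` and dissipation `> ε`. If the sets `Ks N` are eventually level-`N` and
accumulate on `K` in the norm of `H`, then for all large `N` every all-order invariant Galerkin law carried
by `Ks N` has energy `≤ E` and dissipation `≥ ε`.
Proof route: otherwise choose `N_i → ∞` and bad invariant laws `μ_i` carried by `Ks N_i`, all failing the
same clause; eventually `Ks N ⊆ B̄_R` (`K` bounded, accumulation at `η = 1`), so the `μ_i` are admissible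
(level `N_i`, ball `R`, `∀ d, IsPolyStationary` by `isInvariant_iff_forall`) with the uniform enstrophy
budget `∫‖∇u‖²dμ_i ≤ R‖f‖₂/ν` (energy row); `MomentParityResolvedDissipation.stub_tightExtraction` extracts
a limit law `μ_∞` (bounded-continuous convergence + lsc portmanteau), carried by `K` (lsc indicators of the
open sets `(cthickening η K)ᶜ`, `μ_i`-null eventually), stationary for every cylindrical test
(`…LimitSSS.generator_limit`); the window gives `energy μ_∞ < E`, `ε < dissipation μ_∞`, while
`energy μ_∞ = lim energy μ_i ≥ E` (bounded continuous on the ball) or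
`dissipation μ_∞ ≤ liminf dissipation μ_i ≤ ε` (lsc of `eGradNormSq` on `H`) — contradiction. [folklore] -/
theorem stub_upperSemicontinuity :
    ∀ (ν : ℝ) (f : T3 → R3) (E ε : ℝ) (K : Set H3) (Ks : ℕ → Set H3), 0 < ν → Torus.IsSmooth f →
      IsCompact K →
      (∀ μ : Measure H3, IsProbabilityMeasure μ → μ Kᶜ = 0 →
        (∀ Φ : Torus.CylindricalTest (Fin 3),
          Integrable (fun u => Torus.nsGeneratorPairing ν f u (Φ.grad u)) μ ∧
            ∫ u, Torus.nsGeneratorPairing ν f u (Φ.grad u) ∂μ = 0) →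
        Torus.ensembleEnergy μ < E ∧ ε < Torus.ensembleDissipation ν μ) →
      (∀ᶠ N in atTop, ∀ a ∈ Ks N, IsLevel N a) →
      (∀ η : ℝ, 0 < η → ∀ᶠ N in atTop, ∀ a ∈ Ks N, ∃ b ∈ K, ‖a - b‖ < η) →
      ∀ᶠ N in atTop, ∀ μ : Measure H3, IsProbabilityMeasure μ → μ (Ks N)ᶜ = 0 →
        IsInvariant ν f N μ → Torus.ensembleEnergy μ ≤ E ∧ ε ≤ Torus.ensembleDissipation ν μ :=
  Theorems.GalerkinInvariantLoud.UpperSemicontinuity.stub_upperSemicontinuity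

/-- **Stub 3 (XL, LOAD-BEARING; the Galerkin shadow of the card's transfer `C⁺_A`).**
For SOME smooth divergence-free mean-zero force `f`, viscosities `ν_j → 0⁺` and a `j`-UNIFORM window
`E, ε > 0`: at every `j` there is a norm-compact set `K_j ⊆ H` all of whose NS-stationary laws at `(ν_j, f)`
(probability, carried by `K_j`, generator identity for every cylindrical test functional) have energy `< E`
and dissipation `> ε` — the loud isolated invariant set of the card: a hyperbolic periodic orbit, a
horseshoe, a chaotic saddle of transient turbulence — SHADOWED at every large Galerkin level `N` by a
nonempty closed level-`N` set `Ks N`, forward-invariant for the Galerkin dynamics in tested form (every point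
of `Ks N` issues a norm-continuous path in `Ks N` solving the time-integrated Galerkin equations against
every level-`N` band test), the shadows accumulating on `K_j` in the norm of `H`.
Paper route: non-trivial homotopy index of the isolated invariant set `K_j` of the strong NS semiflow +
Rybakowski's continuation theorem along the admissible family of Galerkin semiflows (Rybakowski TAMS 1982,
doi:10.1090/s0002-9947-1982-0637695-7; Hale–Magalhães–Oliva 2002 App. A Thm A.0.25); for hyperbolic
periodic orbits, C¹-convergence of the Galerkin time-`T` maps. Per `j` the structure is inhabited (laminar
Kolmogorov Dirac, `gilFixedViscosity_holds`); the `j`-uniformity of `(E, ε)` is the physics bet (zeroth law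
for shadowed loud carriers). -/
theorem stub_indexedLoudShadows :
    ∃ f : T3 → R3, Torus.IsSmooth f ∧ Torus.IsDivFree f ∧ Torus.HasZeroMean f ∧
      ∃ (ν : ℕ → ℝ) (E ε : ℝ), (∀ j, 0 < ν j) ∧ Tendsto ν atTop (𝓝 0) ∧ 0 < ε ∧
      ∀ j : ℕ, ∃ (K : Set H3) (Ks : ℕ → Set H3), IsCompact K ∧
        (∀ μ : Measure H3, IsProbabilityMeasure μ → μ Kᶜ = 0 →
          (∀ Φ : Torus.CylindricalTest (Fin 3),
            Integrable (fun u => Torus.nsGeneratorPairing (ν j) f u (Φ.grad u)) μ ∧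
              ∫ u, Torus.nsGeneratorPairing (ν j) f u (Φ.grad u) ∂μ = 0) →
          Torus.ensembleEnergy μ < E ∧ ε < Torus.ensembleDissipation (ν j) μ) ∧
        (∀ᶠ N in atTop, (Ks N).Nonempty ∧ IsClosed (Ks N) ∧ (∀ a ∈ Ks N, IsLevel N a) ∧
          ∀ a ∈ Ks N, ∃ U : ℝ → H3, ContinuousOn U (Ici 0) ∧ U 0 = a ∧ (∀ t, 0 ≤ t → U t ∈ Ks N) ∧
            ∀ b : T3 → R3, IsBandTest N b → ∀ s t : ℝ, 0 ≤ s → s ≤ t →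
              Torus.pairing (U t).1 b - Torus.pairing (U s).1 b =
                ∫ τ in s..t, Torus.nsGeneratorPairing (ν j) f (U τ) b) ∧
        (∀ η : ℝ, 0 < η → ∀ᶠ N in atTop, ∀ a ∈ Ks N, ∃ b ∈ K, ‖a - b‖ < η) := by
  sorry

/-! ## The kernel-checked composition -/

/-- **Composition (no `sorry` of its own; uses the three registered stubs BY NAME and concludes the crux BY
NAME).** At each `j`: the radius is `R_j = sup_{K_j} ‖u‖ + 1` (compactness of `K_j` and accumulation at
`η = 1`); for every large `N` pick a point of the shadow `Ks N`, its Galerkin path inside `Ks N`, a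
generalized limit (`GeneralizedLimit.nonempty_holds`) and the time-average law of Stub 1 — carried by the
closed set `Ks N` (`IsTimeAverageMeasure.measure_compl_eq_zero`), hence level-`N`, supported in `‖u‖ ≤ R_j`,
all-order stationary, and loud-bounded by Stub 2; `∀ᶠ N ⇒ ∃ᶠ N`. -/
theorem GalerkinInvariantLoud_of : GalerkinInvariantLoud := by
  have hKB := stub_krylovBogoliubov
  have hUSC := stub_upperSemicontinuity
  have hEx := stub_indexedLoudShadows
  rw [galerkinInvariantLoud_iff]
  obtain ⟨f, hfs, hfd, hfz, ν, E, ε, hν, hν0, hε, hj⟩ := hEx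
  refine ⟨f, hfs, hfd, hfz, ν, E, ε, hν, hν0, hε, fun j => ?_⟩
  obtain ⟨K, Ks, hKc, hloud, hshadow, hacc⟩ := hj j
  -- the radius: `K` is bounded, and the shadows are eventually within distance `1` of `K`
  obtain ⟨R₀, hR₀⟩ := hKc.isBounded.subset_closedBall (0 : H3)
  have hnear : ∀ᶠ N in atTop, ∀ a ∈ Ks N, ‖a‖ ≤ R₀ + 1 := by
    filter_upwards [hacc 1 one_pos] with N hN a ha
    obtain ⟨b, hb, hab⟩ := hN a ha
    have hb' : ‖b‖ ≤ R₀ := mem_closedBall_zero_iff.1 (hR₀ hb)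
    have hsub : ‖a‖ - ‖b‖ ≤ ‖a - b‖ := norm_sub_norm_le a b
    linarith
  -- loud carriers, eventually (Stub 2)
  have hcar := hUSC (ν j) f E ε K Ks (hν j) hfs hKc hloud (hshadow.mono fun N hN => hN.2.2.1) hacc
  refine ⟨R₀ + 1, ((hshadow.and hcar).and hnear).frequently.mono ?_⟩
  rintro N ⟨⟨⟨hne, hcl, hlev, hpath⟩, hcarN⟩, hnearN⟩
  obtain ⟨a, ha⟩ := hne
  obtain ⟨U, hUc, -, hUK, hU⟩ := hpath a ha
  have hlevU : ∀ t, 0 ≤ t → IsLevel N (U t) := fun t ht => hlev (U t) (hUK t ht)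
  have hbound : ∀ t, 0 ≤ t → ‖U t‖ ≤ R₀ + 1 := fun t ht => hnearN (U t) (hUK t ht)
  have hΛ : Nonempty GeneralizedLimit := GeneralizedLimit.nonempty_holds
  obtain ⟨Λ⟩ := hΛ
  obtain ⟨μ, hμ, hinv⟩ := hKB (ν j) f N (R₀ + 1) U hfs hUc hlevU hbound hU Λ
  have hnull : μ (Ks N)ᶜ = 0 := hμ.measure_compl_eq_zero hcl le_rfl hUK
  have hae : ∀ᵐ u ∂μ, u ∈ Ks N := by
    rw [ae_iff]
    exact hnull
  obtain ⟨hE, hD⟩ := hcarN μ hμ.1 hnull hinv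
  exact ⟨μ, hμ.1, hae.mono fun u hu => hlev u hu, hae.mono fun u hu => hnearN u hu, hinv, hE, hD⟩

end Summit.AnomalousDissipation.AnomalousDissipation.Cruxes.GalerkinInvariantLoud.ConleyContinuationLoudSaddles

end
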